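import Summits.QuantumFields.YangMills.Theorems.BalabanUVNodesN16InteriorOfCapture
import Summits.QuantumFields.BalabanUV.T4Continuum.Support.NE3ResidualSliceRep
import HarnessLib

/-!
# Route «BalabanUVNodes» (K3⁷ `SpineGivenEndpointR13SepCoPH`, stmt-QuantumFields-20544), DAG node N16 = NE3 — THE N16 → N19 JUNCTION'S INTERIOR LETTER:
# CAPTURE ⟸ [Balaban1985Variational] THEOREM 1, SENTENCE 2 (THE UNIQUENESS CLAUSE) TYPED AT THE TREE'S TORUS OBJECTS

Cell `pub-ymgap`, width seat `pub-ymgap-dag-n16-w4` (director-ym R399 (3a) ∕ HUMAN RULING D-0149), generation 0, file 1 — over the w1 lineage's files 1∕4∕7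
(`BalabanUVNodesN16H7OfReg9` p584527, `BalabanUVNodesN16H7NoBinding` p593465, `BalabanUVNodesN16InteriorOfCapture` p606074) and the located notes of record on
stmt-QuantumFields-20544: dag-n16-e g16 `LOCATED-N16-INTERIOR-LETTER.md` ((t-N16c), INBOX l.28667; option (R1) «model print's uniqueness») and dag-n16-w1 g4 file 7
(«the interior letter IS CAPTURE»).  Lane word: dag-n16-e g16 «w4 take P1» (INBOX l.29123).  `--kind proof --supports stmt-QuantumFields-20544 --as helper` (count-neutral).

THE POINT.  Under K3⁷ v5's LOOSE pin, N19's (v′-16) value-letter clauses ask for `LeafH3sup 4 L Nper ε b c' dom` with an INTERIOR value letter `b ≤ ε∕2 < ε`; w1 file 7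
proved this EQUIVALENT (modulo Thm 1 (9)–(10)) to CAPTURE(ε → ρ) := «every minimiser of run `k+1` over the closed plaquette ball `sfClass d L N ε` at a datum of `D` lies in
`sfClass d L N ρ (k+1)`», displayed there as a hypothesis.  The tree's print road to the minimisers, [Balaban1985Variational] Thm 1 at leaf-06's torus instances
`Thm1At C (torusVP d L N G (k+1))`, cannot produce it: leaf-06 sets the instance's uniqueness field `UniqueCriticalOrbit := True` (divergence D-s3-5 of
`Support/MinimalActionDictionary`), so `B11Thm1.Unique6` — Thm 1's second sentence p. 279, *"This orbit is a unique critical orbit in the space (6) if B₃ε₁ ≤ ε₀ and ε₀ ≤ a₀"*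
— is VACUOUS there (§1 `unique6_torusVP`).  THIS FILE types that sentence at the tree's torus objects as a displayed hypothesis (0 `def`; D-s3-5 itself untouched) and derives
CAPTURE — hence w1 file 7's interior leaf and N19's rows at the loose pin, BY NAME — from it.  Print's sentence speaks of CRITICAL orbits; the tree has no derivative of the
Wilson action along the constraint manifold, so criticality is a FREE predicate `Crit` and print's two uses of it are displayed separately, as r2's `B11.VarProblemX.Laws` reads
pp. 299–305 (§6 certifies the reading in kernel):
 * (U6) = Thm 1 sentence 2 ∘ `Laws` (iv) at the torus objects: for `0 < ε₁ ≤ a₁`, a loose datum `V ∈ sfClass d L N ε₁ 0` ((7)), `B₃ε₁ ≤ ε₀ ≤ a₀` and `U₀` on a minimal orbit of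
   the space (8) (`IsMinimiser d (sfClass d L N (B₃ε₁)) L N (k+1) V U₀`), every `Crit`-configuration of the space (6) = `sfClass d L N ε₀ (k+1) ∩ {Ū = V}` lies on the GAUGE ORBIT
   of `U₀`: `∃ u` unitary, `(N·L^{k+1})`-periodic, `gaugeAct u U₀ = U` ([Balaban1985Averaging] (8); the group of (4) read on the torus);
 * (ii) = `Laws` (ii) «a configuration on a minimal orbit in `𝔘(e) ∩ 𝔅(V)` is critical», at the radius `e = ε` of the consumer's class.
CAPTURE(ε → B₃ε₁) on loose data for every `B₃ε₁ ≤ ε ≤ a₀` follows (§2–§3): an `ε`-minimiser is critical by (ii), lies in (6) with `ε₀ := ε`, hence on the orbit of (8)'s `U₀` by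
(U6), hence in `sfClass (B₃ε₁)` since the ball is GAUGE INVARIANT (`NE3ResidualSliceRep.mem_sfClass_gaugeAct`; p. 278 *"The space 𝔘_k({Ω_j}, ε₀) is gauge invariant"*).  §5's
pin-level rows display ONE extra row `(ℓ₃ F).ε ≤ (C F).a₀` (print's `ε₀ ≤ a₀` at the class radius).  The `Crit`-free MINIMAL-ORBIT currency («every minimiser over an
intermediate closed ball `sfClass ε₀`, `B₃ε₁ ≤ ε₀ ≤ a₀`, is gauge equivalent to `U₀`») is named once (§2 `capture_of_uniqueMinimalOrbit`) = (U6) with `Crit := IsMinimiser`.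

TWO HONESTY ROWS (dag-n16-e g16's word l.29123).  (i) STRONGER THAN PRINT at the closed ball: print's sentence is about CRITICAL orbits of the OPEN space (6) (strict `<`
in (2)), where (ii) is calculus (a minimum over an open subset of the constraint manifold is critical); the tree's `sfClass` is the CLOSED ball (D-s3-1, `≤`) and `IsMinimiser`
a GLOBAL minimum over it (D-s3-2), so (ii) at the closed ball — equivalently the minimal-orbit currency — asks that closed-ball minimisers with an ACTIVE plaquette constraint be
critical too: a located dictionary law, NOT a printed sentence (the boundary phenomenon of w1 file 4's NO-BINDING and file 5's FRONTS); asserted for nothing here.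
(ii) ACCOUNTING, NOT A DISCHARGE: CAPTURE is WEAKER than (U6) ∧ (ii); the gain is that N19's value-letter clauses now read from [Balaban1985Variational] Thm 1's sentences 1–3
at leaf-06's objects (`Thm1At` ∧ (U6), node N07's theorem) plus ONE located law, instead of an unprinted capture letter; the CONTENT of uniqueness (Props 5–7, pp. 296–301)
is untouched.

WHAT THIS FILE PROVES (kernel, theorems only, 0 `def`, 0 sorry; BY NAME over landed modules).  §1 `unique6_torusVP` (D-s3-5 in kernel), `mem_sfClass_of_orbit`.  §2 one datum,
one run: ★ `capture_of_unique6_of_crit`, `capture_of_uniqueMinimalOrbit`, `minAct_eq_of_unique6_of_crit` (the captured minimiser is a `ρ`-minimiser and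
`A^{ρ} = A^{ε}`: NO-BINDING in equality form follows from uniqueness).  §3 ★★ `capture_of_thm1At_torusVP_of_unique6` (CAPTURE(ε → B₃ε₁) on any `D ⊆ sfClass ε₁ 0`, every run, every `B₃ε₁ ≤ ε ≤ a₀` — EXACTLY w1 file 7's
displayed `hcap`), `capture_B₃_of_thm1At_torusVP_of_unique6` (file 7 §4's per-family `hcap` at print's radius `B₃·(ε∕B)`).  §4 ★ `leafH3sup_interior_of_thm1At_torusVP_of_unique6`
(file 7's interior leaf `LeafH3sup d L N ε ρ (16937ρ) D`, CAPTURE supplied by §3).  §5 at K3⁷ v5's loose pin: ★★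
`leafH3sup_rateCarriers_of_pinnedLoose_of_unique6` (node N19's (v′-16) conjunct at `rateCarriersOfRecord₁₃CoPH 𝔯 F θ hP g₀ os k`, every tuple and run length),
★ `sel_rateCarriers_of_pinnedLoose_of_unique6` (its two `sel` rows).  §6 faithfulness: ★ `thm1At_faithful_iff` (Theorem 1 read at the torus instance whose uniqueness field IS
the (U6) clause ⟺ `Thm1At (torusVP …)` ∧ (U6): the displayed hypothesis is r2's `Unique6` at that instance, quantifier for quantifier), `laws_iv_faithful` (r2's `Laws` (iv)
holds at that instance by construction, `IsCritical := Crit`, `SameOrbit` := the torus gauge orbit).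

HONEST FRAMING.  Elementary nested-class ∕ gauge-orbit logic + bookkeeping over landed theorems BY NAME; [Balaban1985Variational] Thm 1 = the displayed hypotheses `Thm1At`
(sentences 1, 3 at leaf-06's instances, divergences D-s3-1…6) and (U6) (sentence 2, typed here at the same objects), both NODE N07's theorem, asserted for NO family; (ii) = a
displayed dictionary law, located (closed vs open ball), asserted for nothing; `Crit` free.  Nothing of Bałaban asserted or refuted; no stub of K3⁷ v5 (`stub_rates13H` ∕
`stub_expansion13H`) closed; N16 ∕ N19 ∕ N07 NOT discharged; count-neutral (typed 28∕28 · discharged 5∕27 · A 5∕28 unmoved); one finite four-torus at fixed `ε`, Bałaban AS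
PRINTED — NOT ℝ⁴, NOT infinite volume, NOT OS, NOT a mass gap; the YM mass gap (Clay) is NOT proved by any of this — R4 closes the conditional finite-𝕋⁴ rung
`BalabanLadder.UV` only; no summit statement is proved by this seat.  Context: [Balaban1985Variational] CMP **102** (1985) (2)–(8) p. 278, Thm 1 p. 279, Prop. 7 p. 299. -/

set_option autoImplicit false

open scoped BigOperators Matrix Matrix.Norms.L2Operator
open NormedSpace

namespace Summit.QuantumFields.YangMills.BalabanUVNodes.N16CaptureOfUnique6

open Literature.MathematicalPhysics.QuantumFieldTheory.Balaban1983to89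
open Literature.MathematicalPhysics.QuantumFieldTheory.Balaban1983to89.T4Continuum (T4Family ULoop)
open B7Prop1Explicit B7Prop2Explicit MatrixLog UnitaryModel
open T4AveragingDeficitWall hiding Site Plane Plaq Bond
open T4AveragingDeficitWallBoundary (IsPeriodicCfg)
open Summit.QuantumFields.BalabanUV.T4Continuum
open AveragingDeficitLatticeH2Prep (fd)
open MinimalActionSandwich (IsMinimiser admissible minAct)
open MinimalActionRate (sfClass)
open MinimalActionRefine (RegularSup)
open MinimalActionDictionary (torusVP RadiiMono sfClass_mono)
open NE3.LeafIndexSockets (LeafH3sup)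
open NE3EnergyShapes (IsUnitarySite IsPeriodicSite)
open NE3ResidualSliceRep (mem_sfClass_gaugeAct)
open B11 (VarProblemX)
open B11Thm1 (Thm1At Unique6 Exists8 Reg910)
open Node00 (Stage13HParams NE3Letters₁₁ ne3NperOfRecord₁₁ ne3DomOfRecord₁₁ MatA)
open YMDAG.UVSplit (RateReading₁₃CoPH rateCarriersOfRecord₁₃CoPH)
open Summit.QuantumFields.YangMills.BalabanUVNodes.N16H7NoBinding (isMinimiser_of_inflate_of_mem)
open Summit.QuantumFields.YangMills.BalabanUVNodes.N16InteriorOfCapture (leafH3sup_interior_of_thm1At_torusVP_of_capture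
  leafH3sup_rateCarriers_of_pinnedLoose_of_capture_B₃ sel_rateCarriers_of_pinnedLoose_of_capture)
open Summit.QuantumFields.YangMills.BalabanUVNodes.N16PinnedLayer13CoPH (N16PinnedLoose)

noncomputable section

section Generic

variable {d : ℕ} {n : Type} [Fintype n] [DecidableEq n]

/-! ## §1 The uniqueness field of leaf-06's instance is vacuous; the plaquette ball is a union of gauge orbits -/

/-- **D-s3-5 IN KERNEL.**  At leaf-06's torus instance `torusVP` the uniqueness clause `Unique6` of [Balaban1985Variational] Thm 1 (sentence 2, p. 279: *"This orbit is a
unique critical orbit in the space (6) if B₃ε₁ ≤ ε₀ and ε₀ ≤ a₀"*) holds TRIVIALLY, whatever the constants and the datum: the instance's field `UniqueCriticalOrbit` is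
`True` («NOT modelled, weaker than print»).  So `Thm1At C (torusVP …)` carries sentences 1 and 3 only; sentence 2 must be displayed separately (§2–§6). [folklore] -/
theorem unique6_torusVP (L N : ℕ) (G : (Site d → Fin d → (Matrix n n ℂ)ˣ) → Site d → ℕ → ℝ → ℝ → ℝ → Prop) (k : ℕ) (a₀ B₃ ε₁ : ℝ)
    (V : Site d → Fin d → (Matrix n n ℂ)ˣ) : Unique6 (torusVP d L N G k) a₀ B₃ ε₁ V :=
  fun _ _ _ _ _ => trivial

/-- **THE PLAQUETTE BALL IS GAUGE INVARIANT** (p. 278: *"The space 𝔘_k({Ω_j}, ε₀) is gauge invariant"*, read for the tree's closed ball): a configuration on the orbit of a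
member of `sfClass d L N ε k` under a unitary `(N·L^k)`-periodic gauge transformation is a member (`NE3ResidualSliceRep.mem_sfClass_gaugeAct`).
[cite: Balaban1985Variational, (2)+(6) p.278] -/
theorem mem_sfClass_of_orbit [Nonempty n] {L N k : ℕ} {ε : ℝ} {U₀ U : Site d → Fin d → (Matrix n n ℂ)ˣ} (hU₀ : U₀ ∈ sfClass d L N ε k)
    (horb : ∃ u : Site d → (Matrix n n ℂ)ˣ, IsUnitarySite u ∧ IsPeriodicSite u ((N * L ^ k : ℕ) : ℤ) ∧ gaugeAct u U₀ = U) :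
    U ∈ sfClass d L N ε k := by
  obtain ⟨u, hu, huP, rfl⟩ := horb
  exact mem_sfClass_gaugeAct hu huP hU₀

/-! ## §2 One datum, one run: CAPTURE from the uniqueness clause -/

/-- **★ CAPTURE ⟸ (8)-WITNESS ∧ (U6) ∧ (ii), one datum `V`, one run `k+1`, radii `ρ`, `ε`.**  `Crit` is a FREE predicate («`U` is a critical configuration of (5) on the
constraint manifold `{Ū = V}`»).  Hypotheses: `hU₀` — a configuration on a minimal orbit of the space (8) = `sfClass d L N ρ (k+1) ∩ {Ū = V}` (Thm 1 sentence 1's witness);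
`hU6` — Thm 1 sentence 2 through r2's `VarProblemX.Laws` (iv) at `ε₀ := ε`: every `Crit`-configuration of the space (6) = `sfClass d L N ε (k+1) ∩ {Ū = V}` lies on the gauge
orbit of `U₀`; `hcrit` — `Laws` (ii) at radius `ε`: a configuration on a minimal orbit in `sfClass ε ∩ {Ū = V}` is critical.  Conclusion: every minimiser of run `k+1` over
`sfClass d L N ε` with datum `V` lies in `sfClass d L N ρ (k+1)` — by gauge invariance of the ball (§1).  (For print's OPEN spaces `hcrit` is calculus; at the tree's CLOSED
ball it is the located law D-s3-1∕D-s3-2, honesty row (i).) [cite: Balaban1985Variational, Thm 1 p.279] -/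
theorem capture_of_unique6_of_crit [Nonempty n] {L N k : ℕ} {ρ ε : ℝ} {V U₀ : Site d → Fin d → (Matrix n n ℂ)ˣ}
    (Crit : (Site d → Fin d → (Matrix n n ℂ)ˣ) → (Site d → Fin d → (Matrix n n ℂ)ˣ) → Prop)
    (hU₀ : IsMinimiser d (sfClass d L N ρ) L N (k + 1) V U₀)
    (hU6 : ∀ U : Site d → Fin d → (Matrix n n ℂ)ˣ, U ∈ sfClass d L N ε (k + 1) → avgIter L U (k + 1) = V → Crit V U →
      ∃ u : Site d → (Matrix n n ℂ)ˣ, IsUnitarySite u ∧ IsPeriodicSite u ((N * L ^ (k + 1) : ℕ) : ℤ) ∧ gaugeAct u U₀ = U)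
    (hcrit : ∀ U : Site d → Fin d → (Matrix n n ℂ)ˣ, IsMinimiser d (sfClass d L N ε) L N (k + 1) V U → Crit V U)
    {U : Site d → Fin d → (Matrix n n ℂ)ˣ} (hU : IsMinimiser d (sfClass d L N ε) L N (k + 1) V U) :
    U ∈ sfClass d L N ρ (k + 1) :=
  mem_sfClass_of_orbit hU₀.mem.1 (hU6 U hU.mem.1 hU.mem.2 (hcrit U hU))

/-- **CAPTURE ⟸ UNIQUENESS IN MINIMAL-ORBIT CURRENCY** ((U6)∘(ii) as ONE displayed hypothesis): if every minimiser of run `k+1` over `sfClass d L N ε` with datum `V` is gauge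
equivalent to the (8)-witness `U₀ ∈ sfClass d L N ρ (k+1)`, then every such minimiser lies in `sfClass d L N ρ (k+1)`. [cite: Balaban1985Variational, Thm 1 p.279] -/
theorem capture_of_uniqueMinimalOrbit [Nonempty n] {L N k : ℕ} {ρ ε : ℝ} {V U₀ : Site d → Fin d → (Matrix n n ℂ)ˣ}
    (hU₀ : IsMinimiser d (sfClass d L N ρ) L N (k + 1) V U₀)
    (huniq : ∀ U : Site d → Fin d → (Matrix n n ℂ)ˣ, IsMinimiser d (sfClass d L N ε) L N (k + 1) V U →
      ∃ u : Site d → (Matrix n n ℂ)ˣ, IsUnitarySite u ∧ IsPeriodicSite u ((N * L ^ (k + 1) : ℕ) : ℤ) ∧ gaugeAct u U₀ = U)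
    {U : Site d → Fin d → (Matrix n n ℂ)ˣ} (hU : IsMinimiser d (sfClass d L N ε) L N (k + 1) V U) :
    U ∈ sfClass d L N ρ (k + 1) :=
  capture_of_unique6_of_crit (fun V' U' => IsMinimiser d (sfClass d L N ε) L N (k + 1) V' U') hU₀ (fun U' _ _ h => huniq U' h) (fun _ h => h) hU

/-- **… SO THE CAPTURED MINIMISER IS A `ρ`-MINIMISER (`ρ ≤ ε`; w1 file 4 `isMinimiser_of_inflate_of_mem`) AND THE CONSTRAINT OF RADIUS `ρ` DOES NOT BIND IN ENERGY**:
`A^{ρ}_{k+1}(V) = A^{ε}_{k+1}(V)` at every datum carrying an `ε`-minimiser — w1 file 4's NO-BINDING in equality form FOLLOWS from uniqueness. [folklore] -/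
theorem minAct_eq_of_unique6_of_crit [Nonempty n] {L N k : ℕ} {ρ ε : ℝ} (hρε : ρ ≤ ε) {V U₀ : Site d → Fin d → (Matrix n n ℂ)ˣ}
    (Crit : (Site d → Fin d → (Matrix n n ℂ)ˣ) → (Site d → Fin d → (Matrix n n ℂ)ˣ) → Prop)
    (hU₀ : IsMinimiser d (sfClass d L N ρ) L N (k + 1) V U₀)
    (hU6 : ∀ U : Site d → Fin d → (Matrix n n ℂ)ˣ, U ∈ sfClass d L N ε (k + 1) → avgIter L U (k + 1) = V → Crit V U →
      ∃ u : Site d → (Matrix n n ℂ)ˣ, IsUnitarySite u ∧ IsPeriodicSite u ((N * L ^ (k + 1) : ℕ) : ℤ) ∧ gaugeAct u U₀ = U)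
    (hcrit : ∀ U : Site d → Fin d → (Matrix n n ℂ)ˣ, IsMinimiser d (sfClass d L N ε) L N (k + 1) V U → Crit V U)
    {U : Site d → Fin d → (Matrix n n ℂ)ˣ} (hU : IsMinimiser d (sfClass d L N ε) L N (k + 1) V U) :
    IsMinimiser d (sfClass d L N ρ) L N (k + 1) V U ∧ minAct d (sfClass d L N ρ) L N (k + 1) V = minAct d (sfClass d L N ε) L N (k + 1) V := by
  have hUρ : IsMinimiser d (sfClass d L N ρ) L N (k + 1) V U :=
    isMinimiser_of_inflate_of_mem (𝒞 := sfClass d L N ρ) (𝒞' := sfClass d L N ε) (sfClass_mono hρε) hU (capture_of_unique6_of_crit Crit hU₀ hU6 hcrit hU)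
  exact ⟨hUρ, by rw [hUρ.minAct_eq, hU.minAct_eq]⟩

/-! ## §3 From [B11] Theorem 1 at the torus instances: CAPTURE(ε → B₃ε₁) on loose data -/

/-- **★★ CAPTURE ON LOOSE DATA FROM THEOREM 1 WITH ITS UNIQUENESS SENTENCE — EXACTLY w1 file 7's displayed `hcap`.**  Displayed: `hT` — [Balaban1985Variational] Thm 1 at
leaf-06's torus instances of every run (sentences 1 and 3; sentence 2 vacuous there, §1); `hU6` — sentence 2 typed at the SAME objects through a free criticality predicate
`Crit k V U`, quantifiers in r2's `Unique6` order: for `0 < ε₁ ≤ a₁`, a loose datum `V ∈ sfClass d L N ε₁ 0` ((7)), `B₃ε₁ ≤ ε₀ ≤ a₀` and any `U₀` on a minimal orbit of the space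
(8) (radius `B₃ε₁`), every `Crit`-configuration of the space (6) (radius `ε₀`, datum `V`) is on the gauge orbit of `U₀`; `hcrit` — `Laws` (ii) at the consumer's radius `ε`.
Conclusion, for every `B₃ε₁ ≤ ε ≤ a₀` and every `D ⊆ sfClass d L N ε₁ 0`: CAPTURE(ε → B₃ε₁) on `D` — every minimiser of every run `k+1` over `sfClass d L N ε` at a datum of `D`
lies in `sfClass d L N (B₃ε₁) (k+1)`. [cite: Balaban1985Variational, Thm 1 p.279] -/
theorem capture_of_thm1At_torusVP_of_unique6 [Nonempty n] {L N : ℕ}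
    {G : (Site d → Fin d → (Matrix n n ℂ)ˣ) → Site d → ℕ → ℝ → ℝ → ℝ → Prop}
    (C : B11Thm1.Consts) (hT : ∀ k : ℕ, Thm1At C (torusVP d L N G (k + 1)))
    (Crit : ℕ → (Site d → Fin d → (Matrix n n ℂ)ˣ) → (Site d → Fin d → (Matrix n n ℂ)ˣ) → Prop)
    (hU6 : ∀ (k : ℕ) (ε₁ : ℝ), 0 < ε₁ → ε₁ ≤ C.a₁ → ∀ V : Site d → Fin d → (Matrix n n ℂ)ˣ, V ∈ sfClass d L N ε₁ 0 →
      ∀ ε₀ : ℝ, C.B₃ * ε₁ ≤ ε₀ → ε₀ ≤ C.a₀ →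
      ∀ U₀ : Site d → Fin d → (Matrix n n ℂ)ˣ, IsMinimiser d (sfClass d L N (C.B₃ * ε₁)) L N (k + 1) V U₀ →
      ∀ U : Site d → Fin d → (Matrix n n ℂ)ˣ, U ∈ sfClass d L N ε₀ (k + 1) → avgIter L U (k + 1) = V → Crit k V U →
        ∃ u : Site d → (Matrix n n ℂ)ˣ, IsUnitarySite u ∧ IsPeriodicSite u ((N * L ^ (k + 1) : ℕ) : ℤ) ∧ gaugeAct u U₀ = U)
    {ε₁ ε : ℝ} (hε₁ : 0 < ε₁) (hε₁a : ε₁ ≤ C.a₁) (hρε : C.B₃ * ε₁ ≤ ε) (hεa : ε ≤ C.a₀)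
    (hcrit : ∀ (k : ℕ) (V U : Site d → Fin d → (Matrix n n ℂ)ˣ), IsMinimiser d (sfClass d L N ε) L N (k + 1) V U → Crit k V U)
    {D : Set (Site d → Fin d → (Matrix n n ℂ)ˣ)} (hD : D ⊆ sfClass d L N ε₁ 0) :
    ∀ V ∈ D, ∀ (k : ℕ) (U : Site d → Fin d → (Matrix n n ℂ)ˣ),
      IsMinimiser d (sfClass d L N ε) L N (k + 1) V U → U ∈ sfClass d L N (C.B₃ * ε₁) (k + 1) := by
  intro V hV k U hU
  have hV7 : V ∈ sfClass d L N ε₁ 0 := hD hV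
  -- (8): a minimiser `U₀` over the ball of radius `B₃ε₁` at the loose datum `V`
  obtain ⟨⟨U₀, -, -, hU₀⟩, -, -⟩ := hT k ε₁ hε₁ hε₁a V hV7
  have hU₀' : IsMinimiser d (sfClass d L N (C.B₃ * ε₁)) L N (k + 1) V U₀ := hU₀
  exact capture_of_unique6_of_crit (Crit k) hU₀' (hU6 k ε₁ hε₁ hε₁a V hV7 ε hρε hεa U₀ hU₀') (hcrit k V) hU

/-- **CAPTURE AT PRINT'S RADIUS FOR A DATUM RADIUS WRITTEN `ε∕B`** (the shape of w1 file 7 §4's per-family `hcap`): with the class radius `ε`, a divisor `B ≥ B₃ > 0` and the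
rows `0 < ε`, `ε∕B ≤ a₁`, `ε ≤ a₀`, CAPTURE(ε → B₃·(ε∕B)) holds on every `D ⊆ sfClass d L N (ε∕B) 0` (§3 at `ε₁ := ε∕B`; `B₃·(ε∕B) ≤ ε` because `B₃ ≤ B`).
[cite: Balaban1985Variational, Thm 1 p.279] -/
theorem capture_B₃_of_thm1At_torusVP_of_unique6 [Nonempty n] {L N : ℕ}
    {G : (Site d → Fin d → (Matrix n n ℂ)ˣ) → Site d → ℕ → ℝ → ℝ → ℝ → Prop}
    (C : B11Thm1.Consts) (hT : ∀ k : ℕ, Thm1At C (torusVP d L N G (k + 1)))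
    (Crit : ℕ → (Site d → Fin d → (Matrix n n ℂ)ˣ) → (Site d → Fin d → (Matrix n n ℂ)ˣ) → Prop)
    (hU6 : ∀ (k : ℕ) (ε₁ : ℝ), 0 < ε₁ → ε₁ ≤ C.a₁ → ∀ V : Site d → Fin d → (Matrix n n ℂ)ˣ, V ∈ sfClass d L N ε₁ 0 →
      ∀ ε₀ : ℝ, C.B₃ * ε₁ ≤ ε₀ → ε₀ ≤ C.a₀ →
      ∀ U₀ : Site d → Fin d → (Matrix n n ℂ)ˣ, IsMinimiser d (sfClass d L N (C.B₃ * ε₁)) L N (k + 1) V U₀ →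
      ∀ U : Site d → Fin d → (Matrix n n ℂ)ˣ, U ∈ sfClass d L N ε₀ (k + 1) → avgIter L U (k + 1) = V → Crit k V U →
        ∃ u : Site d → (Matrix n n ℂ)ˣ, IsUnitarySite u ∧ IsPeriodicSite u ((N * L ^ (k + 1) : ℕ) : ℤ) ∧ gaugeAct u U₀ = U)
    {ε B : ℝ} (hε : 0 < ε) (hB : 0 < B) (hB₃B : C.B₃ ≤ B) (ha₁ : ε / B ≤ C.a₁) (hεa : ε ≤ C.a₀)
    (hcrit : ∀ (k : ℕ) (V U : Site d → Fin d → (Matrix n n ℂ)ˣ), IsMinimiser d (sfClass d L N ε) L N (k + 1) V U → Crit k V U)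
    {D : Set (Site d → Fin d → (Matrix n n ℂ)ˣ)} (hD : D ⊆ sfClass d L N (ε / B) 0) :
    ∀ V ∈ D, ∀ (k : ℕ) (U : Site d → Fin d → (Matrix n n ℂ)ˣ),
      IsMinimiser d (sfClass d L N ε) L N (k + 1) V U → U ∈ sfClass d L N (C.B₃ * (ε / B)) (k + 1) := by
  have hq : 0 < ε / B := div_pos hε hB
  have hρε : C.B₃ * (ε / B) ≤ ε :=
    calc C.B₃ * (ε / B) ≤ B * (ε / B) := mul_le_mul_of_nonneg_right hB₃B hq.le
      _ = ε := mul_div_cancel₀ _ hB.ne'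
  exact capture_of_thm1At_torusVP_of_unique6 C hT Crit hU6 hq ha₁ hρε hεa hcrit hD

/-! ## §4 The interior leaf, with CAPTURE supplied by §3 (w1 file 7 BY NAME) -/

/-- **★ THE INTERIOR VALUE LETTER FROM THEOREM 1 WITH ITS UNIQUENESS SENTENCE.**  Under w1 file 1 §3's hypotheses on the local-gauge shape (`hGm`, `hG`), the cube-size interface
`hM`, Theorem 1 at the torus instances `hT`, its uniqueness sentence `hU6` (§3) and `Laws` (ii) `hcrit` at the CLASS radius `ε`: for radii `0 < ρ ≤ ε ≤ a₀` with
`ρ ≤ min(B₃a₁, 1∕28)` and data `D ⊆ sfClass d L N (ρ∕B₃) 0`, the leaf (H3ˢᵘᵖ) holds for the class `sfClass d L N ε` with the INTERIOR letters `(b, c) = (ρ, 16937ρ)` —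
w1 file 7's `leafH3sup_interior_of_thm1At_torusVP_of_capture` with CAPTURE(ε → ρ) from §3 at `ε₁ := ρ∕B₃`.  With `ρ ≤ ε∕2` this is the shape of N19's (v′-16) value-letter
clause. [cite: Balaban1985Variational, Thm 1 (8)–(10) p.279] -/
theorem leafH3sup_interior_of_thm1At_torusVP_of_unique6 [Nonempty n] {L N : ℕ} (hL : 1 ≤ L)
    {G : (Site d → Fin d → (Matrix n n ℂ)ˣ) → Site d → ℕ → ℝ → ℝ → ℝ → Prop} (hGm : RadiiMono d G)
    (hG : ∀ (U : Site d → Fin d → (Matrix n n ℂ)ˣ) (x : Site d) (K : ℕ) (α₀ α₁ α₂ : ℝ), 2 ≤ K → G U x K α₀ α₁ α₂ →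
      ∃ (u : Site d → (Matrix n n ℂ)ˣ) (a : Site d → Fin d → Matrix n n ℂ),
        (∀ z, u z ∈ unitaryUnits (Matrix n n ℂ)) ∧
        (∀ (y : Site d) (τ : Fin d), l1 (y - x) ≤ 2 → ((gaugeAct u U y τ : (Matrix n n ℂ)ˣ) : Matrix n n ℂ) = exp (a y τ)) ∧
        (∀ (y : Site d) (τ : Fin d), l1 (y - x) ≤ 2 → ‖a y τ‖ ≤ α₀) ∧
        (∀ (y : Site d) (τ i : Fin d), l1 (y - x) ≤ 1 → ‖fd i (fun z => a z τ) y‖ ≤ α₁) ∧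
        (∀ (τ i l : Fin d), ‖fd i (fd l (fun z => a z τ)) x‖ ≤ α₂))
    (C : B11Thm1.Consts) (hM : ∀ e : ℝ, 0 < e → e ≤ C.a₁ → 7 / 2 ≤ C.Mfun e)
    (hT : ∀ k : ℕ, Thm1At C (torusVP d L N G (k + 1)))
    (Crit : ℕ → (Site d → Fin d → (Matrix n n ℂ)ˣ) → (Site d → Fin d → (Matrix n n ℂ)ˣ) → Prop)
    (hU6 : ∀ (k : ℕ) (ε₁ : ℝ), 0 < ε₁ → ε₁ ≤ C.a₁ → ∀ V : Site d → Fin d → (Matrix n n ℂ)ˣ, V ∈ sfClass d L N ε₁ 0 →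
      ∀ ε₀ : ℝ, C.B₃ * ε₁ ≤ ε₀ → ε₀ ≤ C.a₀ →
      ∀ U₀ : Site d → Fin d → (Matrix n n ℂ)ˣ, IsMinimiser d (sfClass d L N (C.B₃ * ε₁)) L N (k + 1) V U₀ →
      ∀ U : Site d → Fin d → (Matrix n n ℂ)ˣ, U ∈ sfClass d L N ε₀ (k + 1) → avgIter L U (k + 1) = V → Crit k V U →
        ∃ u : Site d → (Matrix n n ℂ)ˣ, IsUnitarySite u ∧ IsPeriodicSite u ((N * L ^ (k + 1) : ℕ) : ℤ) ∧ gaugeAct u U₀ = U)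
    {ρ ε : ℝ} (hρ : 0 < ρ) (hρε : ρ ≤ ε) (hρa : ρ ≤ C.B₃ * C.a₁) (hρ28 : ρ ≤ 1 / 28) (hεa : ε ≤ C.a₀)
    (hcrit : ∀ (k : ℕ) (V U : Site d → Fin d → (Matrix n n ℂ)ˣ), IsMinimiser d (sfClass d L N ε) L N (k + 1) V U → Crit k V U)
    {D : Set (Site d → Fin d → (Matrix n n ℂ)ˣ)} (hD : D ⊆ sfClass d L N (ρ / C.B₃) 0) :
    LeafH3sup d L N ε ρ (16937 * ρ) D := by
  have hB₃ := C.B₃_pos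
  have hε₁a : ρ / C.B₃ ≤ C.a₁ := by rw [div_le_iff₀ hB₃]; linarith [mul_comm C.B₃ C.a₁]
  have hBρ : C.B₃ * (ρ / C.B₃) = ρ := by field_simp
  have hcap := capture_of_thm1At_torusVP_of_unique6 C hT Crit hU6 (div_pos hρ hB₃) hε₁a (by rw [hBρ]; exact hρε) hεa hcrit hD
  rw [hBρ] at hcap
  exact leafH3sup_interior_of_thm1At_torusVP_of_capture hL hGm hG C hM hT hρ hρε hρa hρ28 hD hcap

end Generic

/-! ## §5 At K3⁷ v5's LOOSE PIN: node N19's (v′-16) rows from Theorem 1 with its uniqueness sentence (w1 file 7 §4 BY NAME) -/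

section AtReading

variable {N : ℕ} [NeZero N]

/-- **★★ NODE N19's (v′-16) CONJUNCT `LeafH3sup 4 R.ne3.L R.ne3.Nper R.ne3.ε R.ne3.b c' R.ne3.dom` AT EVERY TUPLE AND RUN LENGTH, UNDER THE LOOSE PIN, FROM THEOREM 1 WITH ITS
UNIQUENESS SENTENCE** — w1 file 7's `leafH3sup_rateCarriers_of_pinnedLoose_of_capture_B₃` with its displayed CAPTURE((ℓ₃ F).ε → (C F).B₃·((ℓ₃ F).ε∕B F)) SUPPLIED per family
by §3 (`capture_B₃_of_thm1At_torusVP_of_unique6`).  Displayed instead: per family, (U6) `hU6` through a free `Crit F`, `Laws` (ii) `hcrit` at the class radius `(ℓ₃ F).ε`, and ONE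
extra row `(ℓ₃ F).ε ≤ (C F).a₀` (print's `ε₀ ≤ a₀` at the class radius).  Other rows as in file 7: the pin `N16PinnedLoose 𝔯 ℓ₃ B`, module 45's Theorem-1 reading
`G F`∕`hGm`∕`hG`∕`C F`∕`hM`∕`hT`, `0 < (ℓ₃ F).ε`, `0 < B F`, `(C F).B₃ ≤ B F`, `(ℓ₃ F).ε∕B F ≤ (C F).a₁`, `(C F).B₃·((ℓ₃ F).ε∕B F) ≤ 1∕28`, the TIGHTENED MATCH ROW
`(C F).B₃·((ℓ₃ F).ε∕B F) ≤ (ℓ₃ F).b` and `16937·(C F).B₃·((ℓ₃ F).ε∕B F) ≤ c'`.  A producer modulo node N07's Theorem 1 (sentences 1–3) and the located law (ii); NOT a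
discharge. [cite: Balaban1985Variational, Thm 1 (8)–(10) p.279] -/
theorem leafH3sup_rateCarriers_of_pinnedLoose_of_unique6 {𝔯 : RateReading₁₃CoPH N} {ℓ₃ : T4Family → NE3Letters₁₁} {B : T4Family → ℝ}
    (hpin : N16PinnedLoose 𝔯 ℓ₃ B)
    {G : T4Family → (Site 4 → Fin 4 → (MatA N)ˣ) → Site 4 → ℕ → ℝ → ℝ → ℝ → Prop} (hGm : ∀ F, RadiiMono 4 (G F))
    (hG : ∀ (F : T4Family) (U : Site 4 → Fin 4 → (MatA N)ˣ) (x : Site 4) (K : ℕ) (α₀ α₁ α₂ : ℝ), 2 ≤ K → G F U x K α₀ α₁ α₂ →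
      ∃ (u : Site 4 → (MatA N)ˣ) (a : Site 4 → Fin 4 → MatA N),
        (∀ z, u z ∈ unitaryUnits (MatA N)) ∧
        (∀ (y : Site 4) (τ : Fin 4), l1 (y - x) ≤ 2 → ((gaugeAct u U y τ : (MatA N)ˣ) : MatA N) = exp (a y τ)) ∧
        (∀ (y : Site 4) (τ : Fin 4), l1 (y - x) ≤ 2 → ‖a y τ‖ ≤ α₀) ∧
        (∀ (y : Site 4) (τ i : Fin 4), l1 (y - x) ≤ 1 → ‖fd i (fun z => a z τ) y‖ ≤ α₁) ∧
        (∀ (τ i l : Fin 4), ‖fd i (fd l (fun z => a z τ)) x‖ ≤ α₂))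
    (C : T4Family → B11Thm1.Consts) (hM : ∀ (F : T4Family) (e : ℝ), 0 < e → e ≤ (C F).a₁ → 7 / 2 ≤ (C F).Mfun e)
    (hT : ∀ (F : T4Family) (k : ℕ), Thm1At (C F) (torusVP 4 F.L (ne3NperOfRecord₁₁ F 0 0) (G F) (k + 1)))
    (Crit : T4Family → ℕ → (Site 4 → Fin 4 → (MatA N)ˣ) → (Site 4 → Fin 4 → (MatA N)ˣ) → Prop)
    (hU6 : ∀ (F : T4Family) (k : ℕ) (ε₁ : ℝ), 0 < ε₁ → ε₁ ≤ (C F).a₁ →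
      ∀ V : Site 4 → Fin 4 → (MatA N)ˣ, V ∈ sfClass 4 F.L (ne3NperOfRecord₁₁ F 0 0) ε₁ 0 →
      ∀ ε₀ : ℝ, (C F).B₃ * ε₁ ≤ ε₀ → ε₀ ≤ (C F).a₀ →
      ∀ U₀ : Site 4 → Fin 4 → (MatA N)ˣ, IsMinimiser 4 (sfClass 4 F.L (ne3NperOfRecord₁₁ F 0 0) ((C F).B₃ * ε₁)) F.L (ne3NperOfRecord₁₁ F 0 0) (k + 1) V U₀ →
      ∀ U : Site 4 → Fin 4 → (MatA N)ˣ, U ∈ sfClass 4 F.L (ne3NperOfRecord₁₁ F 0 0) ε₀ (k + 1) → avgIter F.L U (k + 1) = V → Crit F k V U →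
        ∃ u : Site 4 → (MatA N)ˣ, IsUnitarySite u ∧ IsPeriodicSite u ((ne3NperOfRecord₁₁ F 0 0 * F.L ^ (k + 1) : ℕ) : ℤ) ∧ gaugeAct u U₀ = U)
    (hcrit : ∀ (F : T4Family) (k : ℕ) (V U : Site 4 → Fin 4 → (MatA N)ˣ),
      IsMinimiser 4 (sfClass 4 F.L (ne3NperOfRecord₁₁ F 0 0) (ℓ₃ F).ε) F.L (ne3NperOfRecord₁₁ F 0 0) (k + 1) V U → Crit F k V U)
    (hrows : ∀ F : T4Family, 0 < (ℓ₃ F).ε ∧ 0 < B F ∧ (C F).B₃ ≤ B F ∧ (ℓ₃ F).ε / B F ≤ (C F).a₁ ∧ (C F).B₃ * ((ℓ₃ F).ε / B F) ≤ 1 / 28)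
    (ha₀ : ∀ F : T4Family, (ℓ₃ F).ε ≤ (C F).a₀)
    (F : T4Family) (θ : Stage13HParams F N) (hP : θ.Provisos₁₃CoPH F N) (g₀ : ℕ → ℝ) (os : List (ULoop F)) (k : ℕ)
    {c' : ℝ} (hmatch : (C F).B₃ * ((ℓ₃ F).ε / B F) ≤ (ℓ₃ F).b) (hc' : 16937 * ((C F).B₃ * ((ℓ₃ F).ε / B F)) ≤ c') :
    LeafH3sup 4 (rateCarriersOfRecord₁₃CoPH 𝔯 F θ hP g₀ os k).ne3.L (rateCarriersOfRecord₁₃CoPH 𝔯 F θ hP g₀ os k).ne3.Nper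
      (rateCarriersOfRecord₁₃CoPH 𝔯 F θ hP g₀ os k).ne3.ε (rateCarriersOfRecord₁₃CoPH 𝔯 F θ hP g₀ os k).ne3.b c'
      (rateCarriersOfRecord₁₃CoPH 𝔯 F θ hP g₀ os k).ne3.dom :=
  leafH3sup_rateCarriers_of_pinnedLoose_of_capture_B₃ hpin hGm hG C hM hT hrows
    (fun F' => capture_B₃_of_thm1At_torusVP_of_unique6 (C F') (hT F') (Crit F') (hU6 F') (hrows F').1 (hrows F').2.1 (hrows F').2.2.1
      (hrows F').2.2.2.1 (ha₀ F') (hcrit F') (fun _ hV => hV.2))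
    F θ hP g₀ os k hmatch hc'

/-- **★ NODE N19's (v′-16) `sel` ROWS AT EVERY TUPLE AND RUN LENGTH, UNDER THE LOOSE PIN, FROM (8), (U6), (ii) AND THE LEVEL-0 LEAF** — w1 file 7's
`sel_rateCarriers_of_pinnedLoose_of_capture` at print's radius `ρ F := (C F).B₃·((ℓ₃ F).ε∕B F)` with CAPTURE supplied by §3; rows as in the previous theorem plus file 7's
`(ℓ₃ F).ε ≤ (C F).B₃·(C F).a₁`, `(ℓ₃ F).ε∕B F ≤ min((ℓ₃ F).ε, 1∕4, (ℓ₃ F).b)` and `4·((ℓ₃ F).ε∕B F) ≤ c'`. [cite: Balaban1985Variational, Thm 1 (8)–(10) p.279] -/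
theorem sel_rateCarriers_of_pinnedLoose_of_unique6 {𝔯 : RateReading₁₃CoPH N} {ℓ₃ : T4Family → NE3Letters₁₁} {B : T4Family → ℝ}
    (hpin : N16PinnedLoose 𝔯 ℓ₃ B)
    {G : T4Family → (Site 4 → Fin 4 → (MatA N)ˣ) → Site 4 → ℕ → ℝ → ℝ → ℝ → Prop} (hGm : ∀ F, RadiiMono 4 (G F))
    (hG : ∀ (F : T4Family) (U : Site 4 → Fin 4 → (MatA N)ˣ) (x : Site 4) (K : ℕ) (α₀ α₁ α₂ : ℝ), 2 ≤ K → G F U x K α₀ α₁ α₂ →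
      ∃ (u : Site 4 → (MatA N)ˣ) (a : Site 4 → Fin 4 → MatA N),
        (∀ z, u z ∈ unitaryUnits (MatA N)) ∧
        (∀ (y : Site 4) (τ : Fin 4), l1 (y - x) ≤ 2 → ((gaugeAct u U y τ : (MatA N)ˣ) : MatA N) = exp (a y τ)) ∧
        (∀ (y : Site 4) (τ : Fin 4), l1 (y - x) ≤ 2 → ‖a y τ‖ ≤ α₀) ∧
        (∀ (y : Site 4) (τ i : Fin 4), l1 (y - x) ≤ 1 → ‖fd i (fun z => a z τ) y‖ ≤ α₁) ∧
        (∀ (τ i l : Fin 4), ‖fd i (fd l (fun z => a z τ)) x‖ ≤ α₂))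
    (C : T4Family → B11Thm1.Consts) (hM : ∀ (F : T4Family) (e : ℝ), 0 < e → e ≤ (C F).a₁ → 7 / 2 ≤ (C F).Mfun e)
    (hT : ∀ (F : T4Family) (k : ℕ), Thm1At (C F) (torusVP 4 F.L (ne3NperOfRecord₁₁ F 0 0) (G F) (k + 1)))
    (Crit : T4Family → ℕ → (Site 4 → Fin 4 → (MatA N)ˣ) → (Site 4 → Fin 4 → (MatA N)ˣ) → Prop)
    (hU6 : ∀ (F : T4Family) (k : ℕ) (ε₁ : ℝ), 0 < ε₁ → ε₁ ≤ (C F).a₁ →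
      ∀ V : Site 4 → Fin 4 → (MatA N)ˣ, V ∈ sfClass 4 F.L (ne3NperOfRecord₁₁ F 0 0) ε₁ 0 →
      ∀ ε₀ : ℝ, (C F).B₃ * ε₁ ≤ ε₀ → ε₀ ≤ (C F).a₀ →
      ∀ U₀ : Site 4 → Fin 4 → (MatA N)ˣ, IsMinimiser 4 (sfClass 4 F.L (ne3NperOfRecord₁₁ F 0 0) ((C F).B₃ * ε₁)) F.L (ne3NperOfRecord₁₁ F 0 0) (k + 1) V U₀ →
      ∀ U : Site 4 → Fin 4 → (MatA N)ˣ, U ∈ sfClass 4 F.L (ne3NperOfRecord₁₁ F 0 0) ε₀ (k + 1) → avgIter F.L U (k + 1) = V → Crit F k V U →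
        ∃ u : Site 4 → (MatA N)ˣ, IsUnitarySite u ∧ IsPeriodicSite u ((ne3NperOfRecord₁₁ F 0 0 * F.L ^ (k + 1) : ℕ) : ℤ) ∧ gaugeAct u U₀ = U)
    (hcrit : ∀ (F : T4Family) (k : ℕ) (V U : Site 4 → Fin 4 → (MatA N)ˣ),
      IsMinimiser 4 (sfClass 4 F.L (ne3NperOfRecord₁₁ F 0 0) (ℓ₃ F).ε) F.L (ne3NperOfRecord₁₁ F 0 0) (k + 1) V U → Crit F k V U)
    (hrows : ∀ F : T4Family, 0 < (ℓ₃ F).ε ∧ 0 < B F ∧ (C F).B₃ ≤ B F ∧ (ℓ₃ F).ε / B F ≤ (C F).a₁ ∧ (C F).B₃ * ((ℓ₃ F).ε / B F) ≤ 1 / 28)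
    (ha₀ : ∀ F : T4Family, (ℓ₃ F).ε ≤ (C F).a₀)
    (hεa : ∀ F : T4Family, (ℓ₃ F).ε ≤ (C F).B₃ * (C F).a₁)
    (hε₁ : ∀ F : T4Family, (ℓ₃ F).ε / B F ≤ (ℓ₃ F).ε ∧ (ℓ₃ F).ε / B F ≤ 1 / 4 ∧ (ℓ₃ F).ε / B F ≤ (ℓ₃ F).b)
    (F : T4Family) (θ : Stage13HParams F N) (hP : θ.Provisos₁₃CoPH F N) (g₀ : ℕ → ℝ) (os : List (ULoop F)) (k : ℕ)
    {c' : ℝ} (hmatch : (C F).B₃ * ((ℓ₃ F).ε / B F) ≤ (ℓ₃ F).b) (hc' : 16937 * ((C F).B₃ * ((ℓ₃ F).ε / B F)) ≤ c')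
    (hε₁c : 4 * ((ℓ₃ F).ε / B F) ≤ c') :
    ∃ sel : ℕ → (Site 4 → Fin 4 → (MatA N)ˣ) → (Site 4 → Fin 4 → (MatA N)ˣ),
      (∀ V ∈ (rateCarriersOfRecord₁₃CoPH 𝔯 F θ hP g₀ os k).ne3.dom, ∀ j : ℕ,
        IsMinimiser 4 (sfClass 4 (rateCarriersOfRecord₁₃CoPH 𝔯 F θ hP g₀ os k).ne3.L (rateCarriersOfRecord₁₃CoPH 𝔯 F θ hP g₀ os k).ne3.Nper
          (rateCarriersOfRecord₁₃CoPH 𝔯 F θ hP g₀ os k).ne3.ε) (rateCarriersOfRecord₁₃CoPH 𝔯 F θ hP g₀ os k).ne3.L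
          (rateCarriersOfRecord₁₃CoPH 𝔯 F θ hP g₀ os k).ne3.Nper j V (sel j V)) ∧
      (∀ V ∈ (rateCarriersOfRecord₁₃CoPH 𝔯 F θ hP g₀ os k).ne3.dom, ∀ j : ℕ,
        RegularSup 4 (rateCarriersOfRecord₁₃CoPH 𝔯 F θ hP g₀ os k).ne3.L (rateCarriersOfRecord₁₃CoPH 𝔯 F θ hP g₀ os k).ne3.Nper
          (rateCarriersOfRecord₁₃CoPH 𝔯 F θ hP g₀ os k).ne3.b c' j (sel j V)) := by
  refine sel_rateCarriers_of_pinnedLoose_of_capture hpin hGm hG C hM hT (ρ := fun F => (C F).B₃ * ((ℓ₃ F).ε / B F)) (fun F' => ?_) hεa hε₁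
    (fun F' => capture_B₃_of_thm1At_torusVP_of_unique6 (C F') (hT F') (Crit F') (hU6 F') (hrows F').1 (hrows F').2.1 (hrows F').2.2.1
      (hrows F').2.2.2.1 (ha₀ F') (hcrit F') (fun _ hV => hV.2))
    F θ hP g₀ os k hmatch hc' hε₁c
  -- the capture-radius rows of file 7 at `ρ F := B₃·(ε∕B)`
  obtain ⟨hε, hB, hB₃B, ha₁, h28⟩ := hrows F'
  have hB₃ := (C F').B₃_pos
  have hq : 0 < (ℓ₃ F').ε / B F' := div_pos hε hB
  refine ⟨mul_pos hB₃ hq, ?_, ?_, h28, le_of_eq ?_⟩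
  · calc (C F').B₃ * ((ℓ₃ F').ε / B F') ≤ B F' * ((ℓ₃ F').ε / B F') := mul_le_mul_of_nonneg_right hB₃B hq.le
      _ = (ℓ₃ F').ε := mul_div_cancel₀ _ hB.ne'
  · exact mul_le_mul_of_nonneg_left ha₁ hB₃.le
  · rw [mul_div_cancel_left₀ _ hB₃.ne']

end AtReading

/-! ## §6 Faithfulness: (U6) IS r2's `Unique6` at the torus instance whose uniqueness field is the displayed clause -/

section Faithful

variable {d : ℕ} {n : Type} [Fintype n] [DecidableEq n]

/-- **★ THEOREM 1 READ AT THE PRINT-FAITHFUL TORUS INSTANCE ⟺ `Thm1At (torusVP …)` ∧ (U6).**  Replace, in leaf-06's instance of run `k+1`, the vacuous uniqueness field by the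
(U6) clause through `Crit` — `UniqueCriticalOrbit ε₀ V U₀ := ∀ U ∈ sfClass d L N ε₀ (k+1), Ū = V → Crit V U → U is on the gauge orbit of U₀` (r2's `VarProblemX.Laws` (iv)
reading of *"the orbit of U is the unique critical orbit of (5) in the space (6)"*) — and nothing else: then r2's `B11Thm1.Thm1At` at that instance is EXACTLY leaf-06's
`Thm1At` together with §3's displayed hypothesis `hU6` at run `k+1` (quantifier for quantifier: `Unique6`'s order).  So (U6) is [Balaban1985Variational] Thm 1 sentence 2 in
r2's typing at the tree's objects — no more, no less; D-s3-5 itself is not edited. [cite: Balaban1985Variational, Thm 1 p.279] -/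
theorem thm1At_faithful_iff (L N : ℕ) (G : (Site d → Fin d → (Matrix n n ℂ)ˣ) → Site d → ℕ → ℝ → ℝ → ℝ → Prop) (C : B11Thm1.Consts)
    (Crit : (Site d → Fin d → (Matrix n n ℂ)ˣ) → (Site d → Fin d → (Matrix n n ℂ)ˣ) → Prop) (k : ℕ) :
    Thm1At C { torusVP d L N G (k + 1) with
        UniqueCriticalOrbit := fun ε₀ V U₀ => ∀ U : Site d → Fin d → (Matrix n n ℂ)ˣ, U ∈ sfClass d L N ε₀ (k + 1) → avgIter L U (k + 1) = V →
          Crit V U → ∃ u : Site d → (Matrix n n ℂ)ˣ, IsUnitarySite u ∧ IsPeriodicSite u ((N * L ^ (k + 1) : ℕ) : ℤ) ∧ gaugeAct u U₀ = U } ↔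
      Thm1At C (torusVP d L N G (k + 1)) ∧
      (∀ ε₁ : ℝ, 0 < ε₁ → ε₁ ≤ C.a₁ → ∀ V : Site d → Fin d → (Matrix n n ℂ)ˣ, V ∈ sfClass d L N ε₁ 0 →
        ∀ ε₀ : ℝ, C.B₃ * ε₁ ≤ ε₀ → ε₀ ≤ C.a₀ →
        ∀ U₀ : Site d → Fin d → (Matrix n n ℂ)ˣ, IsMinimiser d (sfClass d L N (C.B₃ * ε₁)) L N (k + 1) V U₀ →
        ∀ U : Site d → Fin d → (Matrix n n ℂ)ˣ, U ∈ sfClass d L N ε₀ (k + 1) → avgIter L U (k + 1) = V → Crit V U →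
          ∃ u : Site d → (Matrix n n ℂ)ˣ, IsUnitarySite u ∧ IsPeriodicSite u ((N * L ^ (k + 1) : ℕ) : ℤ) ∧ gaugeAct u U₀ = U) := by
  constructor
  · intro h
    refine ⟨fun ε₁ h₁ h₂ V hV => ?_, fun ε₁ h₁ h₂ V hV => ?_⟩
    · obtain ⟨h8, -, h910⟩ := h ε₁ h₁ h₂ V hV
      exact ⟨h8, unique6_torusVP L N G (k + 1) C.a₀ C.B₃ ε₁ V, h910⟩
    · obtain ⟨-, h6, -⟩ := h ε₁ h₁ h₂ V hV
      exact h6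
  · rintro ⟨hT, hU6⟩ ε₁ h₁ h₂ V hV
    obtain ⟨h8, -, h910⟩ := hT ε₁ h₁ h₂ V hV
    exact ⟨h8, hU6 ε₁ h₁ h₂ V hV, h910⟩

/-- **r2's `VarProblemX.Laws` (iv) HOLDS AT THE FAITHFUL INSTANCE BY CONSTRUCTION**, with b11's two notions read on the torus as `IsCritical := Crit` and
`SameOrbit U' U := U' is on the gauge orbit of U` (unitary, `(N·L^{k+1})`-periodic `u`, `gaugeAct u U = U'`): *"the orbit of U is the unique critical orbit in (6)" ⇐ U is
critical, lies in (6), and every critical configuration in (6) lies on the orbit of U* — the (U6) field IS that consequent. [cite: Balaban1985Variational, pp.299–305] -/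
theorem laws_iv_faithful (L N : ℕ) (G : (Site d → Fin d → (Matrix n n ℂ)ˣ) → Site d → ℕ → ℝ → ℝ → ℝ → Prop)
    (Crit : (Site d → Fin d → (Matrix n n ℂ)ˣ) → (Site d → Fin d → (Matrix n n ℂ)ˣ) → Prop) (k : ℕ) :
    let P : VarProblemX :=
      { toVarProblem :=
          { torusVP d L N G (k + 1) with
            UniqueCriticalOrbit := fun ε₀ V U₀ => ∀ U : Site d → Fin d → (Matrix n n ℂ)ˣ, U ∈ sfClass d L N ε₀ (k + 1) → avgIter L U (k + 1) = V →
              Crit V U → ∃ u : Site d → (Matrix n n ℂ)ˣ, IsUnitarySite u ∧ IsPeriodicSite u ((N * L ^ (k + 1) : ℕ) : ℤ) ∧ gaugeAct u U₀ = U },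
        IsCritical := Crit,
        SameOrbit := fun U' U => ∃ u : Site d → (Matrix n n ℂ)ˣ, IsUnitarySite u ∧ IsPeriodicSite u ((N * L ^ (k + 1) : ℕ) : ℤ) ∧ gaugeAct u U = U' }
    ∀ (ε₀ : ℝ) (V : P.Bdry) (U : P.Cfg), P.InU ε₀ U → P.InB V U → P.IsCritical V U →
      (∀ U' : P.Cfg, P.InU ε₀ U' → P.InB V U' → P.IsCritical V U' → P.SameOrbit U' U) → P.UniqueCriticalOrbit ε₀ V U := by
  intro P ε₀ V U _ _ _ h U' hU' hB' hC'
  exact h U' hU' hB' hC'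

end Faithful

end

end Summit.QuantumFields.YangMills.BalabanUVNodes.N16CaptureOfUnique6
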